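import Summits.RiemannHypothesis.RiemannHypothesis.Theorems.GapsEvoDoorsInOptInner

/-!
# GapsEvoDoors — IN-OPT certificate, part 4: the three term minorants

Lower bounds of the three outer integrals of `𝓜_{ℓ,f}(φ)` (`ℓ = 19/16`, `f = fS`, `x = πφ ∈ [xLo,
xHi]`): `RCexpr ≤ T_C`-integral, `RAexpr ≤ T_A`-integral, `RBexpr ≤ T_B`-integral — monotone
replacement of `sin(xu)/u`, `sin²(xu)/u` by the rational minorants (signs of the inner integrals and
of `pLo` proved; in the double integral both factors are replaced, the outer integrand's
integrability via `continuous_parametric_primitive_of_continuous`), then evaluation by the list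
calculus. computed-record rung: executes the higher-degree optimisation anticipated in Inoue 2026
(arXiv:2604.05733) Remark 1; no printed constant below 0.508949 under RH alone as of 2026-08;
instrument rows eng-2 j289119/j289121, eng-1 R-aIN-E1-g0-01 j289591/j289692/j289724, referee
VERDICTS.md 3e883a7033d14144 V-2/V-3/V-4; PREREG A1 cd26ffc3f46dafba; conditional on RH and on
`inoue2026_theorem2` (preprint CLAIM); μ-currency RECORD class, not the CI door; computed ≠ proved
outside this kernel certificate; nothing here bears on the truth of RH.
-/

noncomputable section

open MeasureTheory Set Finset Real Literature.NumberTheory.LFunctions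

open scoped Real Interval

set_option linter.dupNamespace false  -- the mandated namespace repeats `RiemannHypothesis`

namespace Summit.RiemannHypothesis.RiemannHypothesis.Theorems.GapsEvoDoorsInOpt

/-! ### 6. Term lower bounds: `T_C` and `T_A` -/

/-- `sin(xu)/u = x·sinc(xu)` for `x, u ≠ 0`. -/
theorem sinc_aux {x u : ℝ} (hx : x ≠ 0) (hu : u ≠ 0) : Real.sin (x * u) / u = x * Real.sinc (x * u) := by
  rw [Real.sinc_of_ne_zero (mul_ne_zero hx hu)]; field_simp

/-- **Term C.** `RCexpr ≤ ∫₀¹ (sin²(xu)/u) C(u) du` for `x ∈ [xLo, xHi]`. -/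
theorem termC_lower {x : ℝ} (hx1 : xLo ≤ x) (hx2 : x ≤ xHi) :
    RCexpr ≤ ∫ u in (0 : ℝ)..1, Real.sin (x * u) ^ 2 / u *
        ∫ v in (0 : ℝ)..(1 - u), fS v ^ 2 * v ^ (105 / 256 : ℝ) := by
  have hx : 0 < x := lt_of_lt_of_le xLo_pos hx1
  have hcongr : (∫ u in (0 : ℝ)..1, Real.sin (x * u) ^ 2 / u *
        ∫ v in (0 : ℝ)..(1 - u), fS v ^ 2 * v ^ (105 / 256 : ℝ))
      = ∫ u in (0 : ℝ)..1, Real.sin (x * u) ^ 2 / u * Ccf u := by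
    refine intervalIntegral.integral_congr fun u hu => ?_
    rw [Set.uIcc_of_le zero_le_one] at hu
    simp only [innerC_eq hu.2]
  rw [hcongr]
  have hsc : Continuous fun u : ℝ => x * Real.sinc (x * u) * Real.sin (x * u) :=
    (continuous_const.mul (Real.continuous_sinc.comp (continuous_const.mul continuous_id))).mul
      (Real.continuous_sin.comp (continuous_const.mul continuous_id))
  have hfi : IntervalIntegrable (fun u : ℝ => Real.sin (x * u) ^ 2 / u * Ccf u) volume 0 1 := by
    refine ((hsc.mul Ccf_continuous).intervalIntegrable 0 1).congr fun u hu => ?_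
    rw [Set.uIoc_of_le zero_le_one] at hu
    have hu0 : u ≠ 0 := hu.1.ne'
    simp only [Pi.mul_apply]
    rw [Real.sinc_of_ne_zero (mul_ne_zero hx.ne' hu0)]
    field_simp
  have hlow : ∫ u in (0 : ℝ)..1, qLo u * Ccf u ≤ ∫ u in (0 : ℝ)..1, Real.sin (x * u) ^ 2 / u * Ccf u := by
    refine intervalIntegral.integral_mono_on_of_le_Ioo zero_le_one
      ((qLo_continuous.mul Ccf_continuous).intervalIntegrable _ _) hfi fun u hu => ?_
    exact mul_le_mul_of_nonneg_right (qLo_le_sin_sq_div hx1 hx2 hu.1) (Ccf_nonneg hu.2.le)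
  refine le_trans (le_of_eq ?_) hlow
  -- evaluation of the minorant integral
  have e1 : ∀ u : ℝ, qLo u * Ccf u = (LC.map (fun t : ℝ × ℕ =>
      qLo u * (t.1 * ((1 - u) ^ ((105 / 256 : ℝ) + 1 + t.2) / (105 / 256 + 1 + t.2))))).sum := by
    intro u; unfold Ccf; rw [← List.sum_map_mul_left]
  simp_rw [e1]
  rw [integral_listSum LC (fun (t : ℝ × ℕ) u => qLo u * (t.1 * ((1 - u) ^ ((105 / 256 : ℝ) + 1 + t.2) / (105 / 256 + 1 + t.2))))]
  · unfold RCexpr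
    congr 1
    apply List.map_congr_left
    intro t _
    rw [elem_C t.1 (by positivity)]
  · intro t
    exact (qLo_continuous.mul (continuous_const.mul ((continuous_sub_rpow 1 (by positivity)).div_const _))).intervalIntegrable _ _

/-- **Term A.** `RAexpr ≤ ∫₀¹ (sin(xu)/u) A(u) du` for `x ∈ [xLo, xHi]`. -/
theorem termA_lower {x : ℝ} (hx1 : xLo ≤ x) (hx2 : x ≤ xHi) :
    RAexpr ≤ ∫ u in (0 : ℝ)..1, Real.sin (x * u) / u *
        ∫ v in (0 : ℝ)..(1 - u), fS v * fS (u + v) * v ^ (105 / 256 : ℝ) := by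
  have hx : 0 < x := lt_of_lt_of_le xLo_pos hx1
  have hcongr : (∫ u in (0 : ℝ)..1, Real.sin (x * u) / u *
        ∫ v in (0 : ℝ)..(1 - u), fS v * fS (u + v) * v ^ (105 / 256 : ℝ))
      = ∫ u in (0 : ℝ)..1, Real.sin (x * u) / u * Acf u := by
    refine intervalIntegral.integral_congr fun u hu => ?_
    rw [Set.uIcc_of_le zero_le_one] at hu
    simp only [innerA_eq hu.2]
  rw [hcongr]
  have hsincc : Continuous fun u : ℝ => x * Real.sinc (x * u) :=
    continuous_const.mul (Real.continuous_sinc.comp (continuous_const.mul continuous_id))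
  have hfi : IntervalIntegrable (fun u : ℝ => Real.sin (x * u) / u * Acf u) volume 0 1 := by
    refine ((hsincc.mul Acf_continuous).intervalIntegrable 0 1).congr fun u hu => ?_
    rw [Set.uIoc_of_le zero_le_one] at hu
    simp only [Pi.mul_apply]
    rw [sinc_aux hx.ne' hu.1.ne']
  have hlow : ∫ u in (0 : ℝ)..1, pLo u * Acf u ≤ ∫ u in (0 : ℝ)..1, Real.sin (x * u) / u * Acf u := by
    refine intervalIntegral.integral_mono_on_of_le_Ioo zero_le_one
      ((pLo_continuous.mul Acf_continuous).intervalIntegrable _ _) hfi fun u hu => ?_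
    exact mul_le_mul_of_nonneg_right (pLo_le_sin_div hx1 hx2 hu.1) (Acf_nonneg hu.1.le hu.2.le)
  refine le_trans (le_of_eq ?_) hlow
  have e1 : ∀ u : ℝ, pLo u * Acf u = (LA.map (fun t : ℝ × ℕ × ℕ =>
      pLo u * (t.1 * u ^ t.2.2 * ((1 - u) ^ ((105 / 256 : ℝ) + 1 + t.2.1) / (105 / 256 + 1 + t.2.1))))).sum := by
    intro u; unfold Acf; rw [← List.sum_map_mul_left]
  simp_rw [e1]
  rw [integral_listSum LA (fun (t : ℝ × ℕ × ℕ) u =>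
      pLo u * (t.1 * u ^ t.2.2 * ((1 - u) ^ ((105 / 256 : ℝ) + 1 + t.2.1) / (105 / 256 + 1 + t.2.1))))]
  · unfold RAexpr
    congr 1
    apply List.map_congr_left
    intro t _
    rw [elem_A t.1 t.2.2 (by positivity)]
  · intro t
    exact (pLo_continuous.mul ((continuous_const.mul (continuous_pow _)).mul
      ((continuous_sub_rpow 1 (by positivity)).div_const _))).intervalIntegrable _ _

/-! ### 7. Term lower bound: `T_B` (double outer integral) -/

/-- The `u₂`-stage of the `T_B` minorant in closed form (`u₁ ≤ 1`). -/
theorem innerLo_eq {u₁ : ℝ} (hu₁ : u₁ ≤ 1) :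
    ∫ u₂ in (0 : ℝ)..(1 - u₁), pLo u₂ * Bcf u₁ u₂ = InnerLo u₁ := by
  have hb : (0 : ℝ) ≤ 1 - u₁ := by linarith
  have e1 : ∀ u₂ : ℝ, pLo u₂ * Bcf u₁ u₂ = (LB.map (fun t : ℝ × ℕ × ℕ × ℕ =>
      pLo u₂ * (t.1 * u₁ ^ t.2.2.1 * u₂ ^ t.2.2.2 *
        ((1 - u₁ - u₂) ^ ((105 / 256 : ℝ) + 1 + t.2.1) / (105 / 256 + 1 + t.2.1))))).sum := by
    intro u₂; unfold Bcf; rw [← List.sum_map_mul_left]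
  simp_rw [e1]
  rw [integral_listSum LB (fun (t : ℝ × ℕ × ℕ × ℕ) u₂ => pLo u₂ * (t.1 * u₁ ^ t.2.2.1 * u₂ ^ t.2.2.2 *
        ((1 - u₁ - u₂) ^ ((105 / 256 : ℝ) + 1 + t.2.1) / (105 / 256 + 1 + t.2.1))))]
  · unfold InnerLo
    congr 1
    apply List.map_congr_left
    intro t _
    rw [elem_inner (t.1 * u₁ ^ t.2.2.1) t.2.2.2 (by positivity) hb]
  · intro t
    exact (pLo_continuous.mul (((continuous_const.mul (continuous_pow _)).mul
      ((continuous_sub_rpow (1 - u₁) (by positivity)).div_const _)))).intervalIntegrable _ _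

/-- The `u₁`-stage of the `T_B` minorant: its value is `RBexpr`. -/
theorem outer_eq : ∫ u₁ in (0 : ℝ)..1, pLo u₁ * InnerLo u₁ = RBexpr := by
  have e1 : ∀ u₁ : ℝ, pLo u₁ * InnerLo u₁ = (LB.map (fun t : ℝ × ℕ × ℕ × ℕ =>
      ∑ m ∈ range 4, pc m * betaJ (2 * m + t.2.2.2) ((105 / 256 : ℝ) + 1 + t.2.1) / (105 / 256 + 1 + t.2.1) *
        (pLo u₁ * (t.1 * u₁ ^ t.2.2.1 *
          ((1 - u₁) ^ (2 * m + t.2.2.2 + 1) * (1 - u₁) ^ ((105 / 256 : ℝ) + 1 + t.2.1)))))).sum := by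
    intro u₁
    unfold InnerLo
    rw [← List.sum_map_mul_left]
    congr 1
    apply List.map_congr_left
    intro t _
    rw [Finset.mul_sum, Finset.mul_sum]
    refine Finset.sum_congr rfl fun m _ => ?_
    ring
  simp_rw [e1]
  have hcont : ∀ (t : ℝ × ℕ × ℕ × ℕ) (m : ℕ), Continuous fun u₁ : ℝ =>
      pc m * betaJ (2 * m + t.2.2.2) ((105 / 256 : ℝ) + 1 + t.2.1) / (105 / 256 + 1 + t.2.1) *
        (pLo u₁ * (t.1 * u₁ ^ t.2.2.1 *
          ((1 - u₁) ^ (2 * m + t.2.2.2 + 1) * (1 - u₁) ^ ((105 / 256 : ℝ) + 1 + t.2.1)))) := by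
    intro t m
    exact continuous_const.mul (pLo_continuous.mul ((continuous_const.mul (continuous_pow _)).mul
      (((continuous_const.sub continuous_id).pow _).mul (continuous_sub_rpow 1 (by positivity)))))
  rw [integral_listSum LB (fun (t : ℝ × ℕ × ℕ × ℕ) u₁ =>
      ∑ m ∈ range 4, pc m * betaJ (2 * m + t.2.2.2) ((105 / 256 : ℝ) + 1 + t.2.1) / (105 / 256 + 1 + t.2.1) *
        (pLo u₁ * (t.1 * u₁ ^ t.2.2.1 *
          ((1 - u₁) ^ (2 * m + t.2.2.2 + 1) * (1 - u₁) ^ ((105 / 256 : ℝ) + 1 + t.2.1)))))]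
  · unfold RBexpr
    congr 1
    apply List.map_congr_left
    intro t _
    unfold rbTerm
    rw [intervalIntegral.integral_finsetSum]
    · refine Finset.sum_congr rfl fun m _ => ?_
      rw [intervalIntegral.integral_const_mul, elem_outer t.1 t.2.2.1 (2 * m + t.2.2.2 + 1) (by positivity)]
    · intro m _
      exact (hcont t m).intervalIntegrable _ _
  · intro t
    exact (continuous_finsetSum _ fun m _ => hcont t m).intervalIntegrable _ _

/-- **Term B.** `RBexpr ≤ ∫₀¹ (sin(xu₁)/u₁) ∫₀^{1−u₁} (sin(xu₂)/u₂) B(u₁,u₂) du₂ du₁` for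
`x ∈ [xLo, xHi]`; both `sin` factors replaced by `pLo ≥ 0`, using `B ≥ 0`. -/
theorem termB_lower {x : ℝ} (hx1 : xLo ≤ x) (hx2 : x ≤ xHi) :
    RBexpr ≤ ∫ u₁ in (0 : ℝ)..1, Real.sin (x * u₁) / u₁ *
        ∫ u₂ in (0 : ℝ)..(1 - u₁), Real.sin (x * u₂) / u₂ *
          ∫ v in (0 : ℝ)..(1 - (u₁ + u₂)),
            (fS v * fS (u₁ + u₂ + v) + fS (u₁ + v) * fS (u₂ + v)) * v ^ (105 / 256 : ℝ) := by
  have hx : 0 < x := lt_of_lt_of_le xLo_pos hx1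
  have hcongr : (∫ u₁ in (0 : ℝ)..1, Real.sin (x * u₁) / u₁ *
        ∫ u₂ in (0 : ℝ)..(1 - u₁), Real.sin (x * u₂) / u₂ *
          ∫ v in (0 : ℝ)..(1 - (u₁ + u₂)),
            (fS v * fS (u₁ + u₂ + v) + fS (u₁ + v) * fS (u₂ + v)) * v ^ (105 / 256 : ℝ))
      = ∫ u₁ in (0 : ℝ)..1, Real.sin (x * u₁) / u₁ *
          ∫ u₂ in (0 : ℝ)..(1 - u₁), Real.sin (x * u₂) / u₂ * Bcf u₁ u₂ := by
    refine intervalIntegral.integral_congr fun u₁ hu₁ => ?_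
    rw [Set.uIcc_of_le zero_le_one] at hu₁
    congr 1
    refine intervalIntegral.integral_congr fun u₂ hu₂ => ?_
    rw [Set.uIcc_of_le (by linarith [hu₁.2] : (0 : ℝ) ≤ 1 - u₁)] at hu₂
    simp only [innerB_eq (by linarith [hu₂.2] : u₁ + u₂ ≤ 1)]
  rw [hcongr]
  have hsincc : Continuous fun u : ℝ => x * Real.sinc (x * u) :=
    continuous_const.mul (Real.continuous_sinc.comp (continuous_const.mul continuous_id))
  have hIc : Continuous fun u₁ : ℝ => ∫ u₂ in (0 : ℝ)..(1 - u₁), x * Real.sinc (x * u₂) * Bcf u₁ u₂ := by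
    have hG : Continuous (Function.uncurry fun (u₁ u₂ : ℝ) => x * Real.sinc (x * u₂) * Bcf u₁ u₂) :=
      (continuous_const.mul (Real.continuous_sinc.comp (continuous_const.mul continuous_snd))).mul Bcf_continuous₂
    exact (intervalIntegral.continuous_parametric_primitive_of_continuous (a₀ := (0 : ℝ)) hG).comp
      (continuous_id.prodMk (continuous_const.sub continuous_id))
  have hI'c : Continuous fun u₁ : ℝ => ∫ u₂ in (0 : ℝ)..(1 - u₁), pLo u₂ * Bcf u₁ u₂ := by
    have hG : Continuous (Function.uncurry fun (u₁ u₂ : ℝ) => pLo u₂ * Bcf u₁ u₂) :=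
      (pLo_continuous.comp continuous_snd).mul Bcf_continuous₂
    exact (intervalIntegral.continuous_parametric_primitive_of_continuous (a₀ := (0 : ℝ)) hG).comp
      (continuous_id.prodMk (continuous_const.sub continuous_id))
  have hlow : ∫ u₁ in (0 : ℝ)..1, pLo u₁ * ∫ u₂ in (0 : ℝ)..(1 - u₁), pLo u₂ * Bcf u₁ u₂
      ≤ ∫ u₁ in (0 : ℝ)..1, Real.sin (x * u₁) / u₁ *
          ∫ u₂ in (0 : ℝ)..(1 - u₁), Real.sin (x * u₂) / u₂ * Bcf u₁ u₂ := by
    refine intervalIntegral.integral_mono_on_of_le_Ioo zero_le_one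
      ((pLo_continuous.mul hI'c).intervalIntegrable _ _) ?_ fun u₁ hu₁ => ?_
    · refine ((hsincc.mul hIc).intervalIntegrable 0 1).congr fun u₁ hu₁ => ?_
      rw [Set.uIoc_of_le zero_le_one] at hu₁
      have hu0 : u₁ ≠ 0 := hu₁.1.ne'
      have hinner : ∫ u₂ in (0 : ℝ)..(1 - u₁), x * Real.sinc (x * u₂) * Bcf u₁ u₂
          = ∫ u₂ in (0 : ℝ)..(1 - u₁), Real.sin (x * u₂) / u₂ * Bcf u₁ u₂ := by
        refine intervalIntegral.integral_congr_ae (ae_of_all _ fun u₂ hu₂ => ?_)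
        rw [Set.uIoc_of_le (by linarith [hu₁.2] : (0 : ℝ) ≤ 1 - u₁)] at hu₂
        rw [sinc_aux hx.ne' hu₂.1.ne']
      simp only [Pi.mul_apply]
      rw [hinner, sinc_aux hx.ne' hu0]
    · obtain ⟨h0, h1⟩ := hu₁
      have hb : (0 : ℝ) ≤ 1 - u₁ := by linarith
      have hBnn : ∀ u₂ ∈ Set.Icc (0 : ℝ) (1 - u₁), 0 ≤ Bcf u₁ u₂ := fun u₂ hu₂ =>
        Bcf_nonneg h0.le hu₂.1 (by linarith [hu₂.2])
      have hI'nn : 0 ≤ ∫ u₂ in (0 : ℝ)..(1 - u₁), pLo u₂ * Bcf u₁ u₂ :=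
        intervalIntegral.integral_nonneg hb fun u₂ hu₂ =>
          mul_nonneg (pLo_nonneg hu₂.1 (by linarith [hu₂.2])) (hBnn u₂ hu₂)
      have hII : ∫ u₂ in (0 : ℝ)..(1 - u₁), pLo u₂ * Bcf u₁ u₂
          ≤ ∫ u₂ in (0 : ℝ)..(1 - u₁), Real.sin (x * u₂) / u₂ * Bcf u₁ u₂ := by
        refine intervalIntegral.integral_mono_on_of_le_Ioo hb ((pLo_continuous.mul (Bcf_continuous u₁)).intervalIntegrable _ _)
          ?_ fun u₂ hu₂ => ?_
        · refine (((hsincc.mul (Bcf_continuous u₁))).intervalIntegrable _ _).congr fun u₂ hu₂ => ?_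
          rw [Set.uIoc_of_le hb] at hu₂
          simp only [Pi.mul_apply]
          rw [sinc_aux hx.ne' hu₂.1.ne']
        · exact mul_le_mul_of_nonneg_right (pLo_le_sin_div hx1 hx2 hu₂.1) (hBnn u₂ ⟨hu₂.1.le, hu₂.2.le⟩)
      have hsin : pLo u₁ ≤ Real.sin (x * u₁) / u₁ := pLo_le_sin_div hx1 hx2 h0
      have hpnn : 0 ≤ pLo u₁ := pLo_nonneg h0.le h1.le
      exact mul_le_mul hsin hII hI'nn (hpnn.trans hsin)
  refine le_trans (le_of_eq ?_) hlow
  have hcongr2 : ∫ u₁ in (0 : ℝ)..1, pLo u₁ * ∫ u₂ in (0 : ℝ)..(1 - u₁), pLo u₂ * Bcf u₁ u₂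
      = ∫ u₁ in (0 : ℝ)..1, pLo u₁ * InnerLo u₁ := by
    refine intervalIntegral.integral_congr fun u₁ hu₁ => ?_
    rw [Set.uIcc_of_le zero_le_one] at hu₁
    simp only [innerLo_eq hu₁.2]
  rw [hcongr2, outer_eq]

end Summit.RiemannHypothesis.RiemannHypothesis.Theorems.GapsEvoDoorsInOpt

end
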